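import Mathlib
import Summits.ValiantsHypothesis.ValiantsHypothesis.Theses.LiouvilleSarnak
import Summits.ValiantsHypothesis.ValiantsHypothesis.Theses.MonotoneRestoration
import Literature.Computability.AlgebraicComplexity.PatternExpressions
import Summits.ValiantsHypothesis.ValiantsHypothesis.Theorems.MonotoneRestorationMonotoneRestorationQPZetaPatterns

/-! Typed sub-questions quoted in the `Lines/*.dead.md` diagnoses of the line-writer seat
`linewriter-valiant-liouvmonotone-1-g0` (2026-08-31).  Elaboration check only; nothing is registered
from this file. -/

namespace Summit.ValiantsHypothesis.ValiantsHypothesis.Cruxes.LineWriterSubquestions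

open Literature.Computability.AlgebraicComplexity

/-- (for stmt-17621 `MultilinearRestorationQP`) **SmNarrowExpression**: a matrix-symmetric family over
`ℝ≥0` with polynomial syntactically-multilinear (monotone) circuit size is presented, order by order, by a
closed labelled pattern expression over `ℂ` with polylogarithmically many labels and quasi-polynomial
length.  ONE STEP from the item: `Theorems.qpSymmetric_patternExpr` (THEOREM ζ-P, landed) turns it into
`MultilinearRestorationQP`. -/
def SmNarrowExpression : Prop :=
  ∀ f : (n : ℕ) → MvPolynomial (Fin n × Fin n) NNReal,
    (∀ (n : ℕ) (σ τ : Equiv.Perm (Fin n)),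
      MvPolynomial.rename (fun p : Fin n × Fin n => (σ p.1, τ p.2)) (f n) = f n) →
    (∃ c : ℕ, ∀ n : ℕ, smCircuitSize (k := NNReal) (f n) ≤ ((n + 2) ^ c : ℕ)) →
    ∃ c : ℕ, ∀ n : ℕ, 1 ≤ n → ∃ (k l : ℕ) (e : PatternExpr ℂ k l),
      n ^ (k + l) ≤ 2 ^ ((Nat.log 2 n + c) ^ c) ∧ e.length ≤ 2 ^ ((Nat.log 2 n + c) ^ c) ∧
      e.close n = MvPolynomial.map (Complex.ofRealHom.comp NNReal.toRealHom) (f n)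

/-- The one-step glue, kernel-checked: `SmNarrowExpression → MultilinearRestorationQP`. -/
theorem multilinearRestorationQP_of_smNarrowExpression (h : SmNarrowExpression) :
    Summit.ValiantsHypothesis.ValiantsHypothesis.Theses.MonotoneRestoration.MultilinearRestorationQP := by
  intro f hsymm hsm
  obtain ⟨c, hc⟩ := h f hsymm hsm
  exact Summit.ValiantsHypothesis.ValiantsHypothesis.Theorems.qpSymmetric_patternExpr
    (fun n => MvPolynomial.map (Complex.ofRealHom.comp NNReal.toRealHom) (f n)) ⟨c, hc⟩

/-- (for stmt-18332 `OrbitCompressionQP`, VH-free half) **OrbitToNarrowExpression**: a square-symmetric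
circuit of quasi-polynomial ORBIT size computing a matrix-symmetric `f_n` yields a closed pattern
expression for `f_n` with polylogarithmically many labels (no length bound) — the Dawar–Pago–Seppelt
direction "small orbits ⇒ small supports ⇒ few labels" at the quasi-polynomial scale. -/
def OrbitToNarrowExpression : Prop :=
  ∀ f : (n : ℕ) → MvPolynomial (Fin n × Fin n) ℂ,
    (∃ c : ℕ, ∀ n : ℕ, ∃ (G : Type) (_ : Fintype G) (C : LabelledArithCircuit ℂ (Fin n × Fin n) Unit G),
      C.IsSymmetric (Equiv.Perm (Fin n)) ∧ C.eval (C.output ()) = f n ∧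
      C.orbitSize (Equiv.Perm (Fin n)) ≤ 2 ^ ((Nat.log 2 n + c) ^ c)) →
    ∃ c : ℕ, ∀ n : ℕ, 1 ≤ n → ∃ (k l : ℕ) (e : PatternExpr ℂ k l),
      n ^ (k + l) ≤ 2 ^ ((Nat.log 2 n + c) ^ c) ∧ e.close n = f n

/-- (for stmt-18332, the `VP`-load-bearing half) **NarrowExpressionCompression**: a matrix-symmetric `VP`
family presented by narrow expressions of SOME length is presented by narrow expressions of
quasi-polynomial length. With `OrbitToNarrowExpression` and THEOREM ζ-P it gives `OrbitCompressionQP`. -/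
def NarrowExpressionCompression : Prop :=
  ∀ f : (n : ℕ) → MvPolynomial (Fin n × Fin n) ℂ,
    (∀ (n : ℕ) (σ τ : Equiv.Perm (Fin n)),
      MvPolynomial.rename (fun p : Fin n × Fin n => (σ p.1, τ p.2)) (f n) = f n) →
    IsVPFamily f →
    (∃ c : ℕ, ∀ n : ℕ, 1 ≤ n → ∃ (k l : ℕ) (e : PatternExpr ℂ k l),
      n ^ (k + l) ≤ 2 ^ ((Nat.log 2 n + c) ^ c) ∧ e.close n = f n) →
    ∃ c : ℕ, ∀ n : ℕ, 1 ≤ n → ∃ (k l : ℕ) (e : PatternExpr ℂ k l),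
      n ^ (k + l) ≤ 2 ^ ((Nat.log 2 n + c) ^ c) ∧ e.length ≤ 2 ^ ((Nat.log 2 n + c) ^ c) ∧
      e.close n = f n

/-- The two-step glue, kernel-checked:
`OrbitToNarrowExpression → NarrowExpressionCompression → OrbitCompressionQP`. -/
theorem orbitCompressionQP_of (hA : OrbitToNarrowExpression) (hB : NarrowExpressionCompression) :
    Summit.ValiantsHypothesis.ValiantsHypothesis.Theses.MonotoneRestoration.OrbitCompressionQP := by
  intro f hsymm hVP horb
  exact Summit.ValiantsHypothesis.ValiantsHypothesis.Theorems.qpSymmetric_patternExpr f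
    (hB f hsymm hVP (hA f horb))

/-- (for stmt-14773 `AlgebraicSarnak`) **ProductSarnak** — algebraic Sarnak for the smallest structured
`VP` class, products of affine-linear univariate factors `Π_i (a_i + b_i X_i)` (`ΠΣ` of support 1), i.e.
orthogonality of `λ(e+1)` to every DIGIT-MULTIPLICATIVE weight `g(e) = Π_i g_i(e_i)`, uniformly:
`|Σ_{e < 2^m} λ(e+1) Π_i g_i(e_i)|² ≤ ε 2^m Π_i (|g_i 0|² + |g_i 1|²)`.  Known for Walsh weights
(`g_i(x) = ±1`: Bourgain 2013) and expected for unimodular `q`-multiplicative weights; open as typed. -/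
def ProductSarnak : Prop :=
  ∀ ε : ℝ, 0 < ε → ∃ m₀ : ℕ, ∀ m ≥ m₀, ∀ g : Fin m → Bool → ℂ,
    ‖∑ e : Fin m → Bool, ((ArithmeticFunction.liouville (Nat.ofBits e + 1) : ℤ) : ℂ) * ∏ i, g i (e i)‖ ^ 2 ≤
      ε * 2 ^ m * ∏ i, (‖g i false‖ ^ 2 + ‖g i true‖ ^ 2)

/-- (for stmt-14773 `AlgebraicSarnak`) **SymmetricSarnak** — algebraic Sarnak for SYMMETRIC cube
polynomials (coefficient of `x^e` depends only on `|e|`; e.g. the elementary symmetric polynomials, all in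
`VP`): `λ(e+1)` is `ℓ²`-unbiased on the digit-sum classes `{e : |e| = j}` (weights `C(m,j)`), a
Drmota–Mauduit–Rivat-type local statement for `λ`. -/
def SymmetricSarnak : Prop :=
  ∀ ε : ℝ, 0 < ε → ∃ m₀ : ℕ, ∀ m ≥ m₀, ∀ a : ℕ → ℂ,
    ‖∑ e : Fin m → Bool, ((ArithmeticFunction.liouville (Nat.ofBits e + 1) : ℤ) : ℂ) *
        a (Finset.univ.filter fun i => e i = true).card‖ ^ 2 ≤
      ε * 2 ^ m * ∑ e : Fin m → Bool, ‖a (Finset.univ.filter fun i => e i = true).card‖ ^ 2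

end Summit.ValiantsHypothesis.ValiantsHypothesis.Cruxes.LineWriterSubquestions
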